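import Literature.NumberTheory.GaloisRepresentations.ArtinDirichletCoefficients
import HarnessLib

/-!
# Route RoughValueTransport, crux RoughValueLaw (stmt-Parity-11390), line friable-deep-tail
## Stub `stub_singularSeriesFactorisation` (S2b₂β), part 1: Euler-product bookkeeping

Generic facts about real arithmetic functions used by the factorisation
`A_f = (∏ᵢ μρ_{fᵢ}) ⋆ E` of the joint-root-count coefficient of a Bateman–Horn system
(`--supports` file of the checked skeleton of the line `friable-deep-tail`):

* `mul_apply_prime_pow`, `mul_apply_prime` — `(f ⋆ g)(p^j) = Σ_{i ≤ j} f(p^i) g(p^{j-i})`;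
* `finsetProd_apply_nonneg`, `finsetProd_apply_prime`, `finsetProd_apply_prime_pow_le` — for a
  finite family of multiplicative `cᵢ ≥ 0` with `cᵢ(p^m) ≤ G^m`:
  `(∏ cᵢ)(p) = Σ cᵢ(p)` and `0 ≤ (∏_{i ∈ s} cᵢ)(p^m) ≤ (m+1)^{#s} G^m`;
* `summable_abs_mul_div_of_local` — the summability criterion: if `A` and `C ≥ 0` are
  multiplicative, `A(p) + C(p) = 0`, `A(p^i) = 0` for `i > k`, `A(p^i) = 0` for `i ≥ 2` and all
  large `p`, and `C(p^m) ≤ (m+1)^k G_p^m` with `0 ≤ G_p ≤ D`, `G_p + 1 ≤ p`, then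
  `Σ_m |(A ⋆ C)(m)|/m < ∞` (the Euler product of `m ↦ (A ⋆ C)(m)/m` has local factors
  `1 + O_{k,D}(p⁻²)`; majorant argument of the tree's `summable_norm_of_summable_norm_prime_pow` and
  `prod_tsum_norm_prime_pow_le_exp`).

Mathlib and `Literature.NumberTheory.GaloisRepresentations.ArtinDirichletCoefficients` only; no
named facts.  The closed form of the criterion is the registered helper sub-goal
`stub_singularSeriesFactorisation_euler`.
-/

noncomputable section

open Filter Finset
open scoped BigOperators

namespace Summit.Parity.BatemanHorn.Cruxes.RoughValueLaw.FriableDeepTail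

namespace SingularSeriesFactorisation

open ArithmeticFunction
open Literature.NumberTheory.GaloisRepresentations

/-! ### Dirichlet products at prime powers -/

/-- Dirichlet product at a prime power: `(f ⋆ g)(p^j) = Σ_{i ≤ j} f(p^i) g(p^{j-i})`. [folklore] -/
theorem mul_apply_prime_pow {R : Type*} [Semiring R] (f g : ArithmeticFunction R) {p : ℕ}
    (hp : p.Prime) (j : ℕ) :
    (f * g) (p ^ j) = ∑ i ∈ range (j + 1), f (p ^ i) * g (p ^ (j - i)) := by
  rw [ArithmeticFunction.mul_apply, Nat.sum_divisorsAntidiagonal (fun x y => f x * g y),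
    Nat.sum_divisors_prime_pow hp]
  refine Finset.sum_congr rfl fun i hi => ?_
  rw [Nat.pow_div (Nat.lt_succ_iff.mp (mem_range.mp hi)) hp.pos]

/-- Dirichlet product of multiplicative functions at a prime: `(f ⋆ g)(p) = f(p) + g(p)`.
[folklore] -/
theorem mul_apply_prime {R : Type*} [CommSemiring R] {f g : ArithmeticFunction R}
    (hf : f.IsMultiplicative) (hg : g.IsMultiplicative) {p : ℕ} (hp : p.Prime) :
    (f * g) p = f p + g p := by
  have h := mul_apply_prime_pow f g hp 1
  rw [pow_one] at h
  rw [h]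
  simp only [sum_range_succ, sum_range_zero, pow_zero, pow_one, Nat.sub_zero, Nat.sub_self,
    hf.map_one, hg.map_one, one_mul, mul_one, zero_add]
  rw [add_comm]

/-! ### Finite Dirichlet products of nonnegative multiplicative functions -/

/-- A finite Dirichlet product of nonnegative real arithmetic functions is nonnegative.
[folklore] -/
theorem finsetProd_apply_nonneg {ι : Type*} (c : ι → ArithmeticFunction ℝ) (s : Finset ι)
    (h0 : ∀ i ∈ s, ∀ n, 0 ≤ c i n) (n : ℕ) : 0 ≤ (∏ i ∈ s, c i) n := by
  induction s using Finset.cons_induction generalizing n with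
  | empty =>
    simp only [prod_empty, one_apply]
    split_ifs <;> norm_num
  | cons a s ha ih =>
    rw [prod_cons, mul_apply]
    exact sum_nonneg fun x _ => mul_nonneg (h0 a (mem_cons_self a s) _)
      (ih (fun i hi => h0 i (mem_cons_of_mem hi)) _)

/-- A finite Dirichlet product of multiplicative functions at a prime is the sum of the values.
[folklore] -/
theorem finsetProd_apply_prime {ι : Type*} (c : ι → ArithmeticFunction ℝ) (s : Finset ι)
    (hc : ∀ i ∈ s, (c i).IsMultiplicative) {p : ℕ} (hp : p.Prime) :
    (∏ i ∈ s, c i) p = ∑ i ∈ s, c i p := by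
  induction s using Finset.cons_induction with
  | empty => simp [one_apply, hp.ne_one]
  | cons a s ha ih =>
    rw [prod_cons, sum_cons, mul_apply_prime (hc a (mem_cons_self a s))
      (isMultiplicative_finsetProd c s fun i hi => hc i (mem_cons_of_mem hi)) hp,
      ih fun i hi => hc i (mem_cons_of_mem hi)]

/-- Prime-power bound for a finite Dirichlet product: if `0 ≤ cᵢ` and `cᵢ(p^m) ≤ G^m` for all
`i ∈ s` and all `m`, then `(∏_{i ∈ s} cᵢ)(p^m) ≤ (m+1)^{#s} G^m`. [folklore] -/
theorem finsetProd_apply_prime_pow_le {ι : Type*} (c : ι → ArithmeticFunction ℝ) (s : Finset ι)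
    (h0 : ∀ i ∈ s, ∀ n, 0 ≤ c i n) {p : ℕ} (hp : p.Prime) {G : ℝ} (hG : 0 ≤ G)
    (hle : ∀ i ∈ s, ∀ m : ℕ, c i (p ^ m) ≤ G ^ m) (m : ℕ) :
    (∏ i ∈ s, c i) (p ^ m) ≤ ((m : ℝ) + 1) ^ #s * G ^ m := by
  induction s using Finset.cons_induction generalizing m with
  | empty =>
    simp only [prod_empty, one_apply, card_empty, pow_zero, one_mul]
    split_ifs with h
    · have hm : m = 0 := by
        by_contra hm
        exact absurd h (ne_of_gt (Nat.one_lt_pow hm hp.one_lt))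
      simp [hm]
    · positivity
  | cons a s ha ih =>
    have h0' : ∀ i ∈ s, ∀ n, 0 ≤ c i n := fun i hi => h0 i (mem_cons_of_mem hi)
    have hle' : ∀ i ∈ s, ∀ m : ℕ, c i (p ^ m) ≤ G ^ m := fun i hi => hle i (mem_cons_of_mem hi)
    rw [prod_cons, mul_apply_prime_pow _ _ hp, card_cons]
    calc ∑ i ∈ range (m + 1), c a (p ^ i) * (∏ i ∈ s, c i) (p ^ (m - i))
        ≤ ∑ i ∈ range (m + 1), G ^ i * ((((m - i : ℕ) : ℝ) + 1) ^ #s * G ^ (m - i)) := by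
          refine sum_le_sum fun i _ => ?_
          exact mul_le_mul (hle a (mem_cons_self a s) i) (ih h0' hle' (m - i))
            (finsetProd_apply_nonneg c s h0' _) (pow_nonneg hG _)
      _ ≤ ∑ _i ∈ range (m + 1), ((m : ℝ) + 1) ^ #s * G ^ m := by
          refine sum_le_sum fun i hi => ?_
          have him : i ≤ m := Nat.lt_succ_iff.mp (mem_range.mp hi)
          have hsub : ((m - i : ℕ) : ℝ) + 1 ≤ (m : ℝ) + 1 := by
            have : ((m - i : ℕ) : ℝ) ≤ m := by exact_mod_cast Nat.sub_le m i
            linarith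
          have hpow : (((m - i : ℕ) : ℝ) + 1) ^ #s ≤ ((m : ℝ) + 1) ^ #s :=
            pow_le_pow_left₀ (by positivity) hsub _
          calc G ^ i * ((((m - i : ℕ) : ℝ) + 1) ^ #s * G ^ (m - i))
              = (((m - i : ℕ) : ℝ) + 1) ^ #s * G ^ m := by
                rw [mul_left_comm, ← pow_add, Nat.add_sub_cancel' him]
            _ ≤ ((m : ℝ) + 1) ^ #s * G ^ m :=
                mul_le_mul_of_nonneg_right hpow (pow_nonneg hG _)
      _ = ((m : ℝ) + 1) ^ (#s + 1) * G ^ m := by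
          rw [sum_const, card_range, nsmul_eq_mul, pow_succ]
          push_cast
          ring

/-! ### The summability criterion -/

/-- **Summability criterion for `A ⋆ C`.**  Let `A`, `C` be multiplicative real arithmetic
functions with `C ≥ 0`, `A(p) + C(p) = 0` for every prime `p`, `A(p^i) = 0` for `i > k`,
`A(p^i) = 0` for `i ≥ 2` and `p > P₀`, and `C(p^m) ≤ (m+1)^k G_p^m` with `0 ≤ G_p ≤ D` and
`G_p + 1 ≤ p`.  Then `Σ_m |(A ⋆ C)(m)|/m < ∞`.
Proof: `m ↦ (A ⋆ C)(m)/m` is multiplicative with value `1` at `1` and `0` at every prime; at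
`p^j` it is bounded by the Cauchy product of the finitely supported `|A(p^i)|/p^i` and the
summable `C(p^m)/p^m ≤ (m+1)^k (G_p/p)^m` (`G_p/p < 1`), so each local series converges; for
`p > max(P₀, 2D)` only `i = 0, 1` contribute, `|(A ⋆ C)(p^{m+2})| ≤ (1 + 2^k)(m+3)^k G_p^{m+2}` and
`G_p/p ≤ min(D/p, 1/2)`, so the local excess is `≤ K/p²`; the finitely many small primes are
absorbed into the constant, and the tree's majorant lemmas
(`summable_norm_of_summable_norm_prime_pow`, `prod_tsum_norm_prime_pow_le_exp`) conclude.
[folklore] -/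
theorem summable_abs_mul_div_of_local {k : ℕ} {A C : ArithmeticFunction ℝ}
    (hA : A.IsMultiplicative) (hC : C.IsMultiplicative) (hC0 : ∀ n, 0 ≤ C n)
    (hAC : ∀ p : ℕ, p.Prime → A p + C p = 0)
    (hAk : ∀ p : ℕ, p.Prime → ∀ i : ℕ, k < i → A (p ^ i) = 0)
    {P₀ : ℕ} (hA2 : ∀ p : ℕ, p.Prime → P₀ < p → ∀ i : ℕ, 2 ≤ i → A (p ^ i) = 0)
    {D : ℝ} (hCG : ∀ p : ℕ, p.Prime → ∃ G : ℝ, 0 ≤ G ∧ G ≤ D ∧ G + 1 ≤ p ∧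
      ∀ m : ℕ, C (p ^ m) ≤ ((m : ℝ) + 1) ^ k * G ^ m) :
    Summable (fun m : ℕ => |(A * C) m| / m) := by
  set E : ArithmeticFunction ℝ := A * C with hEdef
  have hE : E.IsMultiplicative := hA.mul hC
  -- the complex-valued multiplicative function `F(m) = E(m)/m`
  set F : ℕ → ℂ := fun m => ((E m / m : ℝ) : ℂ) with hF
  have hnF : ∀ m, ‖F m‖ = |E m| / m := fun m => by
    simp only [hF, Complex.norm_real, Real.norm_eq_abs, abs_div, Nat.abs_cast]
  have hF1 : F 1 = 1 := by simp [hF, hE.map_one]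
  have hFmul : ∀ {m n : ℕ}, m.Coprime n → F (m * n) = F m * F n := by
    intro m n hmn
    simp only [hF, hE.map_mul_of_coprime hmn, Nat.cast_mul]
    push_cast
    ring
  -- prime-power values of `E`
  have hEpow : ∀ {p : ℕ}, p.Prime → ∀ j : ℕ,
      E (p ^ j) = ∑ i ∈ range (j + 1), A (p ^ i) * C (p ^ (j - i)) :=
    fun hp j => mul_apply_prime_pow A C hp j
  have hEp : ∀ {p : ℕ}, p.Prime → E p = 0 := by
    intro p hp
    rw [hEdef, mul_apply_prime hA hC hp]
    exact hAC p hp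
  -- local majorant `|E(p^j)|/p^j ≤ Σ_{i+m=j} (|A(p^i)|/p^i)(C(p^m)/p^m)`
  have hloc : ∀ {p : ℕ}, p.Prime → ∀ j : ℕ, ‖F (p ^ j)‖ ≤
      ∑ x ∈ antidiagonal j, |A (p ^ x.1)| / (p : ℝ) ^ x.1 * (C (p ^ x.2) / (p : ℝ) ^ x.2) := by
    intro p hp j
    have hp0 : (0 : ℝ) < p := by exact_mod_cast hp.pos
    rw [hnF, Nat.sum_antidiagonal_eq_sum_range_succ
      (fun a b => |A (p ^ a)| / (p : ℝ) ^ a * (C (p ^ b) / (p : ℝ) ^ b)) j, hEpow hp j,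
      Nat.cast_pow]
    calc |∑ i ∈ range (j + 1), A (p ^ i) * C (p ^ (j - i))| / (p : ℝ) ^ j
        ≤ (∑ i ∈ range (j + 1), |A (p ^ i) * C (p ^ (j - i))|) / (p : ℝ) ^ j :=
          div_le_div_of_nonneg_right (abs_sum_le_sum_abs _ _) (by positivity)
      _ = ∑ i ∈ range (j + 1),
            |A (p ^ i)| / (p : ℝ) ^ i * (C (p ^ (j - i)) / (p : ℝ) ^ (j - i)) := by
          rw [sum_div]
          refine sum_congr rfl fun i hi => ?_
          have hij : i ≤ j := Nat.lt_succ_iff.mp (mem_range.mp hi)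
          rw [abs_mul, abs_of_nonneg (hC0 _),
            show (p : ℝ) ^ j = (p : ℝ) ^ i * (p : ℝ) ^ (j - i) by
              rw [← pow_add, Nat.add_sub_cancel' hij],
            mul_div_mul_comm]
  -- summability of the majorant at every prime
  have hmaj : ∀ {p : ℕ}, p.Prime → Summable (fun j : ℕ =>
      ∑ x ∈ antidiagonal j, |A (p ^ x.1)| / (p : ℝ) ^ x.1 * (C (p ^ x.2) / (p : ℝ) ^ x.2)) := by
    intro p hp
    obtain ⟨G, hG0, -, hGp, hCm⟩ := hCG p hp
    have hp0 : (0 : ℝ) < p := by exact_mod_cast hp.pos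
    have hu : Summable (fun i : ℕ => |A (p ^ i)| / (p : ℝ) ^ i) := by
      refine summable_of_ne_finset_zero (s := range (k + 1)) fun i hi => ?_
      rw [mem_range, not_lt] at hi
      rw [hAk p hp i (by omega), abs_zero, zero_div]
    have hx1 : G / p < 1 := by rw [div_lt_one hp0]; linarith
    have hx0 : 0 ≤ G / p := div_nonneg hG0 hp0.le
    have hv : Summable (fun m : ℕ => C (p ^ m) / (p : ℝ) ^ m) := by
      have hs : Summable (fun m : ℕ => ((m : ℝ) + (1 : ℕ)) ^ k * (G / p) ^ m) :=
        summable_natCast_add_pow_mul_pow 1 k (by rwa [Real.norm_of_nonneg hx0])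
      refine Summable.of_nonneg_of_le (fun m => div_nonneg (hC0 _) (pow_nonneg hp0.le _))
        (fun m => ?_) hs
      rw [Nat.cast_one, div_pow, ← mul_div_assoc, div_le_div_iff_of_pos_right (pow_pos hp0 _)]
      exact hCm m
    have hu0 : ∀ i, 0 ≤ |A (p ^ i)| / (p : ℝ) ^ i := fun i =>
      div_nonneg (abs_nonneg _) (pow_nonneg hp0.le _)
    have hv0 : ∀ m, 0 ≤ C (p ^ m) / (p : ℝ) ^ m := fun m =>
      div_nonneg (hC0 _) (pow_nonneg hp0.le _)
    exact summable_sum_mul_antidiagonal_of_summable_mul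
      (f := fun i => |A (p ^ i)| / (p : ℝ) ^ i) (g := fun m => C (p ^ m) / (p : ℝ) ^ m)
      (hu.mul_of_nonneg hv hu0 hv0)
  -- every local series converges
  have hsumF : ∀ {p : ℕ}, p.Prime → Summable (fun j : ℕ => ‖F (p ^ j)‖) := fun hp =>
    (hmaj hp).of_nonneg_of_le (fun _ => norm_nonneg _) (hloc hp)
  -- constants
  have hhalf : ‖(1 / 2 : ℝ)‖ < 1 := by
    rw [Real.norm_of_nonneg (by norm_num)]
    norm_num
  set S : ℝ := ∑' m : ℕ, ((m : ℝ) + (3 : ℕ)) ^ k * (1 / 2 : ℝ) ^ m with hS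
  have hSsum : Summable (fun m : ℕ => ((m : ℝ) + (3 : ℕ)) ^ k * (1 / 2 : ℝ) ^ m) :=
    summable_natCast_add_pow_mul_pow 3 k hhalf
  have hS0 : 0 ≤ S := tsum_nonneg fun m => by positivity
  have hD0 : 0 ≤ D := by
    obtain ⟨G, hG0, hGD, -⟩ := hCG 2 Nat.prime_two
    linarith
  set K : ℝ := (1 + 2 ^ k) * D ^ 2 * S with hK
  have hK0 : 0 ≤ K := by positivity
  set P₁ : ℕ := max P₀ ⌈2 * D⌉₊ with hP₁
  -- the local excess `t'(p) = Σ_{j ≥ 2} |E(p^j)|/p^j`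
  set t' : ℕ → ℝ := fun p => ∑' j : ℕ, ‖F (p ^ (j + 2))‖ with ht'
  have ht'0 : ∀ p, 0 ≤ t' p := fun p => tsum_nonneg fun _ => norm_nonneg _
  -- good primes: `t'(p) ≤ K/p²`
  have hgood : ∀ {p : ℕ}, p.Prime → P₁ < p → t' p ≤ K / (p : ℝ) ^ 2 := by
    intro p hp hP
    obtain ⟨G, hG0, hGD, hGp, hCm⟩ := hCG p hp
    have hp0 : (0 : ℝ) < p := by exact_mod_cast hp.pos
    have hP0p : P₀ < p := lt_of_le_of_lt (le_max_left _ _) hP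
    have h2D : 2 * D ≤ p := by
      have h1 : ⌈2 * D⌉₊ < p := lt_of_le_of_lt (le_max_right _ _) hP
      have h2 : (⌈2 * D⌉₊ : ℝ) < p := by exact_mod_cast h1
      linarith [Nat.le_ceil (2 * D)]
    have hxhalf : G / p ≤ 1 / 2 := by
      rw [div_le_iff₀ hp0]
      linarith
    have hx0 : 0 ≤ G / p := div_nonneg hG0 hp0.le
    -- only `i = 0, 1` contribute beyond `P₀`
    have hEval : ∀ m : ℕ, E (p ^ (m + 2)) = C (p ^ (m + 2)) + A p * C (p ^ (m + 1)) := by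
      intro m
      rw [hEpow hp, sum_range_succ', sum_range_succ', sum_eq_zero (fun i _ => ?_)]
      · have e1 : m + 2 - (0 + 1) = m + 1 := by omega
        rw [e1]
        simp only [zero_add, pow_one, pow_zero, Nat.sub_zero, hA.map_one, one_mul]
        ring
      · rw [hA2 p hp hP0p (i + 1 + 1) (by omega), zero_mul]
    have hAp : |A p| ≤ 2 ^ k * G := by
      have h1 : A p = -C p := by linarith [hAC p hp]
      have h2 : C (p ^ 1) ≤ (((1 : ℕ) : ℝ) + 1) ^ k * G ^ 1 := hCm 1
      rw [pow_one, Nat.cast_one, pow_one] at h2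
      rw [h1, abs_neg, abs_of_nonneg (hC0 p)]
      calc C p ≤ ((1 : ℝ) + 1) ^ k * G := h2
        _ = 2 ^ k * G := by norm_num
    -- pointwise bound at `p^(m+2)`
    have hpt : ∀ m : ℕ, ‖F (p ^ (m + 2))‖ ≤
        (1 + 2 ^ k) * D ^ 2 / (p : ℝ) ^ 2 * (((m : ℝ) + (3 : ℕ)) ^ k * (1 / 2 : ℝ) ^ m) := by
      intro m
      rw [hnF, hEval m]
      have hC2 : C (p ^ (m + 2)) ≤ ((m : ℝ) + 3) ^ k * G ^ (m + 2) := by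
        have h := hCm (m + 2)
        have e : (((m + 2 : ℕ) : ℝ) + 1) = (m : ℝ) + 3 := by push_cast; ring
        rwa [e] at h
      have hC1 : C (p ^ (m + 1)) ≤ ((m : ℝ) + 3) ^ k * G ^ (m + 1) := by
        have h := hCm (m + 1)
        have e : (((m + 1 : ℕ) : ℝ) + 1) = (m : ℝ) + 2 := by push_cast; ring
        rw [e] at h
        have : ((m : ℝ) + 2) ^ k ≤ ((m : ℝ) + 3) ^ k :=
          pow_le_pow_left₀ (by positivity) (by linarith) k
        exact h.trans (mul_le_mul_of_nonneg_right this (pow_nonneg hG0 _))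
      have hnum : |C (p ^ (m + 2)) + A p * C (p ^ (m + 1))| ≤
          (1 + 2 ^ k) * ((m : ℝ) + 3) ^ k * G ^ (m + 2) := by
        calc |C (p ^ (m + 2)) + A p * C (p ^ (m + 1))|
            ≤ |C (p ^ (m + 2))| + |A p * C (p ^ (m + 1))| := abs_add_le _ _
          _ = C (p ^ (m + 2)) + |A p| * C (p ^ (m + 1)) := by
              rw [abs_of_nonneg (hC0 _), abs_mul, abs_of_nonneg (hC0 _)]
          _ ≤ ((m : ℝ) + 3) ^ k * G ^ (m + 2) +
                2 ^ k * G * (((m : ℝ) + 3) ^ k * G ^ (m + 1)) :=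
              add_le_add hC2 (mul_le_mul hAp hC1 (hC0 _) (by positivity))
          _ = (1 + 2 ^ k) * ((m : ℝ) + 3) ^ k * G ^ (m + 2) := by ring
      have hp2 : (0 : ℝ) < (p : ℝ) ^ (m + 2) := pow_pos hp0 _
      rw [Nat.cast_pow, div_le_iff₀ hp2]
      have h1 : (G / p) ^ 2 ≤ (D / p) ^ 2 :=
        pow_le_pow_left₀ hx0 (div_le_div_of_nonneg_right hGD hp0.le) 2
      have h2 : (G / p) ^ m ≤ (1 / 2) ^ m := pow_le_pow_left₀ hx0 hxhalf m
      have h3 : (0 : ℝ) ≤ (1 + 2 ^ k) * ((m : ℝ) + 3) ^ k := by positivity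
      have e : G ^ (m + 2) = (G / p) ^ (m + 2) * (p : ℝ) ^ (m + 2) := by
        rw [div_pow, div_mul_cancel₀ _ (pow_ne_zero _ hp0.ne')]
      have h4 : (G / p) ^ (m + 2) ≤ (D / p) ^ 2 * (1 / 2) ^ m := by
        rw [pow_add, mul_comm]
        exact mul_le_mul h1 h2 (by positivity) (by positivity)
      calc |C (p ^ (m + 2)) + A p * C (p ^ (m + 1))|
          ≤ (1 + 2 ^ k) * ((m : ℝ) + 3) ^ k * G ^ (m + 2) := hnum
        _ = (1 + 2 ^ k) * ((m : ℝ) + 3) ^ k * (G / p) ^ (m + 2) * (p : ℝ) ^ (m + 2) := by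
            rw [e]
            ring
        _ ≤ (1 + 2 ^ k) * ((m : ℝ) + 3) ^ k * ((D / p) ^ 2 * (1 / 2) ^ m) *
              (p : ℝ) ^ (m + 2) :=
            mul_le_mul_of_nonneg_right (mul_le_mul_of_nonneg_left h4 h3) hp2.le
        _ = (1 + 2 ^ k) * D ^ 2 / (p : ℝ) ^ 2 * (((m : ℝ) + (3 : ℕ)) ^ k * (1 / 2 : ℝ) ^ m) *
              (p : ℝ) ^ (m + 2) := by
            push_cast
            rw [div_pow]
            ring
    have hs2 : Summable (fun m : ℕ => ‖F (p ^ (m + 2))‖) :=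
      (summable_nat_add_iff (f := fun j : ℕ => ‖F (p ^ j)‖) 2).mpr (hsumF hp)
    calc t' p = ∑' m : ℕ, ‖F (p ^ (m + 2))‖ := rfl
      _ ≤ ∑' m : ℕ, (1 + 2 ^ k) * D ^ 2 / (p : ℝ) ^ 2 *
            (((m : ℝ) + (3 : ℕ)) ^ k * (1 / 2 : ℝ) ^ m) :=
          hs2.tsum_le_tsum hpt (hSsum.mul_left _)
      _ = K / (p : ℝ) ^ 2 := by
          rw [tsum_mul_left, hK]
          ring
  -- all primes: absorb the finitely many `p ≤ P₁`
  set K₀ : ℝ := ∑ q ∈ (range (P₁ + 1)).filter Nat.Prime, t' q * (q : ℝ) ^ 2 with hK₀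
  have hK₀0 : 0 ≤ K₀ := sum_nonneg fun q _ => mul_nonneg (ht'0 q) (by positivity)
  have hall : ∀ p : Nat.Primes, t' p ≤ (K + K₀) / ((p : ℕ) : ℝ) ^ 2 := by
    intro p
    have hp : (p : ℕ).Prime := p.2
    have hp0 : (0 : ℝ) < (p : ℕ) := by exact_mod_cast hp.pos
    have hp2 : (0 : ℝ) < ((p : ℕ) : ℝ) ^ 2 := pow_pos hp0 2
    rw [le_div_iff₀ hp2]
    rcases lt_or_ge P₁ p with hP | hP
    · have h1 : t' p * ((p : ℕ) : ℝ) ^ 2 ≤ K := (le_div_iff₀ hp2).mp (hgood hp hP)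
      linarith
    · have hmem : (p : ℕ) ∈ (range (P₁ + 1)).filter Nat.Prime := by
        rw [mem_filter, mem_range]
        exact ⟨Nat.lt_succ_of_le hP, hp⟩
      have h1 : t' p * ((p : ℕ) : ℝ) ^ 2 ≤ K₀ :=
        single_le_sum (f := fun q => t' q * (q : ℝ) ^ 2)
          (fun q _ => mul_nonneg (ht'0 q) (by positivity)) hmem
      linarith
  -- summability of the local excesses over the primes
  set t : Nat.Primes → ℝ := fun p => t' p with ht
  have ht0 : ∀ p, 0 ≤ t p := fun p => ht'0 p
  have htsum : Summable t := by
    have h2 : Summable (fun p : Nat.Primes => (K + K₀) * ((p : ℕ) : ℝ) ^ (-2 : ℝ)) :=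
      ((Nat.Primes.summable_rpow).mpr (by norm_num)).mul_left _
    refine Summable.of_nonneg_of_le ht0 (fun p => ?_) h2
    have hp0 : (0 : ℝ) ≤ (p : ℕ) := by positivity
    rw [Real.rpow_neg hp0, Real.rpow_two, ← div_eq_mul_inv]
    exact hall p
  -- `Σ_j |E(p^j)|/p^j = 1 + 0 + t(p)`
  have hle : ∀ p : Nat.Primes, ∑' j : ℕ, ‖F ((p : ℕ) ^ j)‖ ≤ 1 + t p := by
    intro p
    have hp : (p : ℕ).Prime := p.2
    have hs := hsumF hp
    have hs1 : Summable (fun j : ℕ => ‖F ((p : ℕ) ^ (j + 1))‖) :=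
      (summable_nat_add_iff (f := fun j : ℕ => ‖F ((p : ℕ) ^ j)‖) 1).mpr hs
    have h0 : ‖F ((p : ℕ) ^ 0)‖ = 1 := by rw [pow_zero, hF1, norm_one]
    have h1 : ‖F ((p : ℕ) ^ (0 + 1))‖ = 0 := by
      rw [zero_add, pow_one, hnF, hEp hp, abs_zero, zero_div]
    have h2 : ∑' j : ℕ, ‖F ((p : ℕ) ^ (j + 1 + 1))‖ = t p := rfl
    rw [hs.tsum_eq_zero_add, hs1.tsum_eq_zero_add, h0, h1, h2, zero_add]
  -- the majorant argument
  have hB := fun s : Finset ℕ => prod_tsum_norm_prime_pow_le_exp (f := F) ht0 htsum hle s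
  have hsum : Summable fun n => ‖F n‖ :=
    summable_norm_of_summable_norm_prime_pow hF1 hFmul hsumF hB
  exact hsum.congr fun m => hnF m

end SingularSeriesFactorisation

/-- **Registered helper sub-goal (part 1 of `stub_singularSeriesFactorisation`)**: the
summability criterion `summable_abs_mul_div_of_local` as a closed statement. [folklore] -/
theorem stub_singularSeriesFactorisation_euler :
    ∀ (k : ℕ) (A C : ArithmeticFunction ℝ), A.IsMultiplicative → C.IsMultiplicative →
      (∀ n : ℕ, 0 ≤ C n) → (∀ p : ℕ, p.Prime → A p + C p = 0) →
      (∀ p : ℕ, p.Prime → ∀ i : ℕ, k < i → A (p ^ i) = 0) →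
      ∀ P₀ : ℕ, (∀ p : ℕ, p.Prime → P₀ < p → ∀ i : ℕ, 2 ≤ i → A (p ^ i) = 0) →
      ∀ D : ℝ, (∀ p : ℕ, p.Prime → ∃ G : ℝ, 0 ≤ G ∧ G ≤ D ∧ G + 1 ≤ p ∧
        ∀ m : ℕ, C (p ^ m) ≤ ((m : ℝ) + 1) ^ k * G ^ m) →
      Summable (fun m : ℕ => |(A * C) m| / m) :=
  fun _ _ _ hA hC hC0 hAC hAk _ hA2 _ hCG =>
    SingularSeriesFactorisation.summable_abs_mul_div_of_local hA hC hC0 hAC hAk hA2 hCG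

end Summit.Parity.BatemanHorn.Cruxes.RoughValueLaw.FriableDeepTail

end
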